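import Mathlib
import Summits.Ventures.HodgeRepro2.Tier7.Line3.HeckeWindowSums

/-!
# Tier7/Line3/HeckeWindowLocus — the failure locus of the Hecke window at a place (U1′)

Filer: t7-L1-p3 (gen 6, prover-pub-hodge-repro2-t7-L1-p3-g6-0), TARGET line STATUS l. 15572; a one-topic follow-up of
U1 (t7-lead l. 15499; HeckeWindowCounts p686209 + HeckeWindowSums p686403, crit-2 CLEARED l. 15559) importing
`HeckeWindowSums` by name; sharpens HECKE-WINDOW-p3.md §6 and crit-2's record (vi). Lane: Line 3 SUPPORT, [M]-level;
NOT a line, NOT a device; touches neither residual clause (a′) nor (b′) of the line.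

WHAT IT SUPPLIES. L3-ARGUMENT.md v18 §3b needs a split place `v₂ ∉ S` at which the window's orbital integral
`O_{γ₀}(f_{v₂}) = vol · windowOrb χ κ c` (`HeckeWindowSums`: `windowOrb χ κ c = β₁ β₂ − c κ σ + c²`,
`σ = β₁ + β₂ + α₁⁻¹ + α₂⁻¹ = orbSum χ 1 0`, `κ = q_{v₂}^{−1/2}`, `c = χ_V⁻¹(ϖ_{v₂})`) is NON-ZERO. This file describes,
at ONE place and for UNITARY data (`‖α_i‖ = ‖β_i‖ = ‖c‖ = 1`: unramified unitary characters), exactly when it vanishes: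

* (L1) `σ` FACTORS: `σ = (β₁ + α₂⁻¹)(1 + α₂ β₂)` (the central relation `α₁⁻¹ = α₂ β₁ β₂`), hence
  `σ = 0 ⟺ α₂ β₁ = −1 ∨ α₂ β₂ = −1` (`sigma_eq_zero_iff`) and `‖σ‖ ≤ 4` (`norm_sigma_le`).
* (L2) `windowOrb = 0 ⇒ c² + β₁ β₂ = c κ σ ⇒ ‖ψ + 1‖ ≤ 4 ‖κ‖` for the unit-circle invariant `ψ := c² (β₁ β₂)⁻¹`
  (`norm_psi_add_one_le_of_windowOrb_eq_zero`): a vanishing window forces `ψ` within `4 q^{−1/2}` of `−1`.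
* (L3) THE DEGENERATE CASE `ψ = −1` (`c² = −β₁ β₂`): `windowOrb = −c κ σ`, so it vanishes iff `σ = 0`
  (`windowOrb_eq_zero_iff_of_sq_eq_neg`).
* (L4) THE GAP: for every `N ≥ 1` there is `δ_N > 0` with `δ_N ≤ ‖ζ + 1‖` for every `N`-th root of unity `ζ ≠ −1`
  (`exists_gap_rootsOfUnity`; the minimum over a finite set). Hence if `ψ` has finite order `N`, `ψ ≠ −1` and
  `4 ‖κ‖ < δ_N`, the window is NON-ZERO (`windowOrb_ne_zero_of_rootOfUnity`).
* (L5) THE LOCUS: `windowOrb = 0 ⇒ (ψ = −1 ∧ σ = 0) ∨ (ψ ≠ −1 ∧ ‖ψ + 1‖ ≤ 4 ‖κ‖)` (`windowOrb_eq_zero_imp`); for `ψ` of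
  finite order `N` and `4 ‖κ‖ < δ_N`: `windowOrb = 0 ⟺ ψ = −1 ∧ σ = 0` (`windowOrb_eq_zero_iff_of_rootOfUnity`).

READING FOR §3b (in words; NOT typed — the residual's print column). Globally `ψ(ϖ_v) = (χ_V^{−2} · (μ_{B,1} μ_{B,2})^{−1})(ϖ_v)`
and `σ_v = 0 ⟺ (μ_{A,2} μ_{B,1})(ϖ_v) = −1 ∨ (μ_{A,2} μ_{B,2})(ϖ_v) = −1` at the split place `v` (characters transported
to the diagonal torus). The window works at every split `v₂ ∉ S` with `‖ψ(ϖ_{v₂}) + 1‖ > 4 q_{v₂}^{−1/2}`; for `ψ` of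
finite order `N` that is every split `v₂` with `q_{v₂} > (4/δ_N)²` and `ψ(ϖ_{v₂}) ≠ −1`, a set of positive density
(Chebotarev on the compositum of `E′` with the class field of `ψ`: the identity class has `ψ(Frob) = 1 ≠ −1 — print);
for `ψ` of infinite order, every split `v₂` with `q_{v₂} > 16` and `‖ψ(ϖ_{v₂}) + 1‖ ≥ 1`, infinitely many by
equidistribution (Hecke — print). In neither case is §3b's cubic variant needed. CORRECTION of record: HECKE-WINDOW-p3.md
§6 (v1) and the LANDED line l. 15552 (vi) placed `ψ` near `1`; the sign is `−1` (`c² + β₁ β₂ = c κ σ`, not `c² − β₁ β₂`).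

NOT in this file: the dictionary (which Hecke characters `ψ`, `μ_{A,2} μ_{B,i}` are; that the real `U(W_A)(F_v)` etc. are
the model's objects — (a′)); Chebotarev / equidistribution (print); anything about `X`; nothing about the step (P).

§8(d) (uses an L-value-free non-vanishing device): NO — elementary inequalities on the unit circle.
-/

namespace Summit.Ventures.HodgeRepro2.Tier7.Line3.HeckeWindow

/-- (L1) Unitary data: the four character values lie on the unit circle. -/
def UnramChar.Unitary (χ : UnramChar) : Prop :=
  ‖χ.α₁‖ = 1 ∧ ‖χ.α₂‖ = 1 ∧ ‖χ.β₁‖ = 1 ∧ ‖χ.β₂‖ = 1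

/-- (L1) The `T_ϖ`-coefficient `σ = β₁ + β₂ + α₁⁻¹ + α₂⁻¹` (`= orbSum χ 1 0`). -/
noncomputable def sigma (χ : UnramChar) : ℂ := χ.β₁ + χ.β₂ + χ.α₁⁻¹ + χ.α₂⁻¹

/-- (L1) `σ = orbSum χ 1 0`, the `T_ϖ` orbital sum. -/
theorem sigma_eq_orbSum (χ : UnramChar) : sigma χ = orbSum χ 1 0 := (orbSum_one_zero χ).symm

/-- (L1) FACTORISATION: `σ = (β₁ + α₂⁻¹)(1 + α₂ β₂)` (central relation `α₁⁻¹ = α₂ β₁ β₂`). -/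
theorem sigma_eq_mul (χ : UnramChar) : sigma χ = (χ.β₁ + χ.α₂⁻¹) * (1 + χ.α₂ * χ.β₂) := by
  unfold sigma
  have h := χ.α₂_mul_β₁_mul_β₂
  have hinv : χ.α₂⁻¹ * χ.α₂ = 1 := inv_mul_cancel₀ χ.α₂_ne_zero
  linear_combination (-1 : ℂ) * h - χ.β₂ * hinv

/-- (L1) `σ = 0 ⟺ α₂ β₁ = −1 ∨ α₂ β₂ = −1`: the `T_ϖ` orbital sum vanishes iff one of the two products of character
values is `−1`. -/
theorem sigma_eq_zero_iff (χ : UnramChar) : sigma χ = 0 ↔ χ.α₂ * χ.β₁ = -1 ∨ χ.α₂ * χ.β₂ = -1 := by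
  have hα₂ := χ.α₂_ne_zero
  rw [sigma_eq_mul, mul_eq_zero]
  constructor
  · rintro (h | h)
    · left
      have h' : χ.α₂ * (χ.β₁ + χ.α₂⁻¹) = 0 := by rw [h, mul_zero]
      rw [mul_add, mul_inv_cancel₀ hα₂] at h'
      linear_combination h'
    · right
      linear_combination h
  · rintro (h | h)
    · left
      have h' : χ.α₂⁻¹ * (χ.α₂ * χ.β₁ + 1) = 0 := by rw [h]; ring
      rw [mul_add, ← mul_assoc, inv_mul_cancel₀ hα₂, one_mul, mul_one] at h'
      exact h'
    · right
      linear_combination h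

/-- (L1) `‖σ‖ ≤ 4` for unitary data. -/
theorem norm_sigma_le (χ : UnramChar) (hχ : χ.Unitary) : ‖sigma χ‖ ≤ 4 := by
  obtain ⟨h1, h2, h3, h4⟩ := hχ
  unfold sigma
  calc ‖χ.β₁ + χ.β₂ + χ.α₁⁻¹ + χ.α₂⁻¹‖ ≤ ‖χ.β₁ + χ.β₂ + χ.α₁⁻¹‖ + ‖χ.α₂⁻¹‖ := norm_add_le _ _
    _ ≤ (‖χ.β₁‖ + ‖χ.β₂‖ + ‖χ.α₁⁻¹‖) + ‖χ.α₂⁻¹‖ := add_le_add norm_add₃_le le_rfl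
    _ = 4 := by rw [norm_inv, norm_inv, h1, h2, h3, h4]; norm_num

/-! ## L2. A vanishing window pins `ψ` near `−1` -/

/-- (L2) The unit-circle invariant `ψ = c² (β₁ β₂)⁻¹` (globally `χ_V^{−2} · (μ_{B,1} μ_{B,2})^{−1}` at the place). -/
noncomputable def psi (χ : UnramChar) (c : ℂ) : ℂ := c ^ 2 * (χ.β₁ * χ.β₂)⁻¹

/-- (L2) `‖ψ‖ = 1` for unitary data and `‖c‖ = 1`. -/
theorem norm_psi (χ : UnramChar) (hχ : χ.Unitary) (c : ℂ) (hc : ‖c‖ = 1) : ‖psi χ c‖ = 1 := by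
  unfold psi
  rw [norm_mul, norm_pow, norm_inv, norm_mul, hc, hχ.2.2.1, hχ.2.2.2]
  norm_num

/-- (L2) `ψ = −1 ⟺ c² = −β₁ β₂`. -/
theorem psi_eq_neg_one_iff (χ : UnramChar) (c : ℂ) : psi χ c = -1 ↔ c ^ 2 = -(χ.β₁ * χ.β₂) := by
  have hβ0 : χ.β₁ * χ.β₂ ≠ 0 := mul_ne_zero χ.β₁_ne_zero χ.β₂_ne_zero
  unfold psi
  rw [mul_inv_eq_iff_eq_mul₀ hβ0]
  constructor <;> intro h <;> linear_combination h

/-- (L2) If the window vanishes then `c² + β₁ β₂ = c κ σ`. -/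
theorem sq_add_eq_of_windowOrb_eq_zero (χ : UnramChar) (κ c : ℂ) (h : windowOrb χ κ c = 0) :
    c ^ 2 + χ.β₁ * χ.β₂ = c * κ * sigma χ := by
  rw [windowOrb_eq] at h
  unfold sigma
  linear_combination h

/-- (L2) For unitary data a vanishing window forces `‖c² + β₁ β₂‖ ≤ 4 ‖κ‖`. -/
theorem norm_sq_add_le_of_windowOrb_eq_zero (χ : UnramChar) (hχ : χ.Unitary) (κ c : ℂ) (hc : ‖c‖ = 1)
    (h : windowOrb χ κ c = 0) : ‖c ^ 2 + χ.β₁ * χ.β₂‖ ≤ 4 * ‖κ‖ := by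
  rw [sq_add_eq_of_windowOrb_eq_zero χ κ c h, norm_mul, norm_mul, hc, one_mul]
  calc ‖κ‖ * ‖sigma χ‖ ≤ ‖κ‖ * 4 := mul_le_mul_of_nonneg_left (norm_sigma_le χ hχ) (norm_nonneg _)
    _ = 4 * ‖κ‖ := mul_comm _ _

/-- (L2) For unitary data a vanishing window forces `‖ψ + 1‖ ≤ 4 ‖κ‖`: `ψ` lies within `4 q^{−1/2}` of `−1`. -/
theorem norm_psi_add_one_le_of_windowOrb_eq_zero (χ : UnramChar) (hχ : χ.Unitary) (κ c : ℂ)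
    (hc : ‖c‖ = 1) (h : windowOrb χ κ c = 0) : ‖psi χ c + 1‖ ≤ 4 * ‖κ‖ := by
  have hβ : ‖χ.β₁ * χ.β₂‖ = 1 := by rw [norm_mul, hχ.2.2.1, hχ.2.2.2, one_mul]
  have hβ0 : χ.β₁ * χ.β₂ ≠ 0 := mul_ne_zero χ.β₁_ne_zero χ.β₂_ne_zero
  have e : psi χ c + 1 = (c ^ 2 + χ.β₁ * χ.β₂) * (χ.β₁ * χ.β₂)⁻¹ := by
    unfold psi
    rw [add_mul, mul_inv_cancel₀ hβ0]
  rw [e, norm_mul, norm_inv, hβ, inv_one, mul_one]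
  exact norm_sq_add_le_of_windowOrb_eq_zero χ hχ κ c hc h

/-! ## L3. The degenerate case `ψ = −1` -/

/-- (L3) In the degenerate case `c² = −β₁ β₂` the window is `−c κ σ`. -/
theorem windowOrb_of_sq_eq_neg (χ : UnramChar) (κ c : ℂ) (h : c ^ 2 = -(χ.β₁ * χ.β₂)) :
    windowOrb χ κ c = -(c * κ * sigma χ) := by
  rw [windowOrb_eq]
  unfold sigma
  linear_combination h

/-- (L3) Degenerate case, `c κ ≠ 0`: the window vanishes iff `σ = 0`. -/
theorem windowOrb_eq_zero_iff_of_sq_eq_neg (χ : UnramChar) (κ c : ℂ) (hκ : κ ≠ 0) (hc : c ≠ 0)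
    (h : c ^ 2 = -(χ.β₁ * χ.β₂)) : windowOrb χ κ c = 0 ↔ sigma χ = 0 := by
  rw [windowOrb_of_sq_eq_neg χ κ c h, neg_eq_zero, mul_eq_zero, mul_eq_zero]
  simp [hκ, hc]

/-! ## L4. The gap at roots of unity -/

/-- (L4) THE GAP: for each `N ≥ 1` there is `δ > 0` with `δ ≤ ‖ζ + 1‖` for every `N`-th root of unity `ζ ≠ −1`. -/
theorem exists_gap_rootsOfUnity (N : ℕ) (hN : 0 < N) :
    ∃ δ : ℝ, 0 < δ ∧ ∀ ζ : ℂ, ζ ^ N = 1 → ζ ≠ -1 → δ ≤ ‖ζ + 1‖ := by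
  classical
  set S : Finset ℂ := (Polynomial.nthRootsFinset N (1 : ℂ)).erase (-1) with hS
  have hmem : ∀ ζ : ℂ, ζ ^ N = 1 → ζ ≠ -1 → ζ ∈ S := by
    intro ζ hζ hζ1
    rw [hS, Finset.mem_erase]
    exact ⟨hζ1, (Polynomial.mem_nthRootsFinset hN 1).mpr hζ⟩
  by_cases hSe : S.Nonempty
  · obtain ⟨ζ₀, hζ₀, hmin⟩ := S.exists_min_image (fun ζ => ‖ζ + 1‖) hSe
    refine ⟨‖ζ₀ + 1‖, ?_, fun ζ hζ hζ1 => hmin ζ (hmem ζ hζ hζ1)⟩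
    have h1 : ζ₀ ≠ -1 := (Finset.mem_erase.mp hζ₀).1
    have h2 : ζ₀ + 1 ≠ 0 := fun h => h1 (by linear_combination h)
    exact norm_pos_iff.mpr h2
  · refine ⟨1, one_pos, fun ζ hζ hζ1 => ?_⟩
    exact absurd ⟨ζ, hmem ζ hζ hζ1⟩ hSe

/-- (L4) FINITE ORDER: if `ψ` is an `N`-th root of unity, `ψ ≠ −1`, and `4 ‖κ‖ < δ_N`, the window does not vanish. -/
theorem windowOrb_ne_zero_of_rootOfUnity (χ : UnramChar) (hχ : χ.Unitary) (κ c : ℂ) (hc : ‖c‖ = 1)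
    (N : ℕ) (δ : ℝ) (hδ : ∀ ζ : ℂ, ζ ^ N = 1 → ζ ≠ -1 → δ ≤ ‖ζ + 1‖)
    (hψ : psi χ c ^ N = 1) (hψ1 : psi χ c ≠ -1) (hκ : 4 * ‖κ‖ < δ) : windowOrb χ κ c ≠ 0 := by
  intro h
  have h1 := norm_psi_add_one_le_of_windowOrb_eq_zero χ hχ κ c hc h
  have h2 := hδ _ hψ hψ1
  linarith

/-! ## L5. The failure locus -/

/-- (L5) THE FAILURE LOCUS at a place (unitary data, `κ ≠ 0`): the window vanishes only if either `ψ = −1 ∧ σ = 0`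
(degenerate) or `ψ ≠ −1 ∧ ‖ψ + 1‖ ≤ 4 ‖κ‖`. -/
theorem windowOrb_eq_zero_imp (χ : UnramChar) (hχ : χ.Unitary) (κ c : ℂ) (hc : ‖c‖ = 1) (hκ : κ ≠ 0)
    (h : windowOrb χ κ c = 0) :
    (psi χ c = -1 ∧ sigma χ = 0) ∨ (psi χ c ≠ -1 ∧ ‖psi χ c + 1‖ ≤ 4 * ‖κ‖) := by
  by_cases hψ : psi χ c = -1
  · left
    refine ⟨hψ, ?_⟩
    have hc0 : c ≠ 0 := by
      intro h0
      rw [h0, norm_zero] at hc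
      exact zero_ne_one hc
    exact (windowOrb_eq_zero_iff_of_sq_eq_neg χ κ c hκ hc0 ((psi_eq_neg_one_iff χ c).mp hψ)).mp h
  · right
    exact ⟨hψ, norm_psi_add_one_le_of_windowOrb_eq_zero χ hχ κ c hc h⟩

/-- (L5) FINITE ORDER, EXACT: for `ψ` an `N`-th root of unity and `4 ‖κ‖ < δ_N`, the window vanishes iff
`ψ = −1 ∧ σ = 0` — i.e. iff `ψ = −1` and (`α₂ β₁ = −1` or `α₂ β₂ = −1`). -/
theorem windowOrb_eq_zero_iff_of_rootOfUnity (χ : UnramChar) (hχ : χ.Unitary) (κ c : ℂ) (hc : ‖c‖ = 1)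
    (hκ : κ ≠ 0) (N : ℕ) (δ : ℝ) (hδ : ∀ ζ : ℂ, ζ ^ N = 1 → ζ ≠ -1 → δ ≤ ‖ζ + 1‖)
    (hψ : psi χ c ^ N = 1) (hκδ : 4 * ‖κ‖ < δ) :
    windowOrb χ κ c = 0 ↔ psi χ c = -1 ∧ sigma χ = 0 := by
  constructor
  · intro h
    rcases windowOrb_eq_zero_imp χ hχ κ c hc hκ h with h' | ⟨hψ1, _⟩
    · exact h'
    · exact absurd h (windowOrb_ne_zero_of_rootOfUnity χ hχ κ c hc N δ hδ hψ hψ1 hκδ)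
  · rintro ⟨hψ1, hσ⟩
    have hc0 : c ≠ 0 := by
      intro h0
      rw [h0, norm_zero] at hc
      exact zero_ne_one hc
    exact (windowOrb_eq_zero_iff_of_sq_eq_neg χ κ c hκ hc0 ((psi_eq_neg_one_iff χ c).mp hψ1)).mpr hσ

/-- (L5) NON-VANISHING away from the locus: unitary data, `‖ψ + 1‖ > 4 ‖κ‖` ⇒ the window is non-zero
(the form used in words for §3b: every split place with `‖ψ(ϖ_v) + 1‖ > 4 q_v^{−1/2}` works). -/
theorem windowOrb_ne_zero_of_norm_psi_add_one (χ : UnramChar) (hχ : χ.Unitary) (κ c : ℂ) (hc : ‖c‖ = 1)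
    (hfar : 4 * ‖κ‖ < ‖psi χ c + 1‖) : windowOrb χ κ c ≠ 0 := by
  intro h
  have := norm_psi_add_one_le_of_windowOrb_eq_zero χ hχ κ c hc h
  linarith

end Summit.Ventures.HodgeRepro2.Tier7.Line3.HeckeWindow
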